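import Summits.ABC.ABC.Theorems.DefiniteXiPolyFreyDegreeValuation
import HarnessLib

/-!
# Route DefiniteXi — item `FreyValuationBound` (stmt-ABC-14677) from ANY Baker-shape bound

The item (valuation input `hval` of the weak rung
`Summit.ABC.ABC.Theorems.DefiniteXiPolyFreyDegree.polyFreyDegree_of_xiBound_of_valuationBound`) reads:
`∃ B K, ∀ a b` coprime, `ab(a+b) ≠ 0`, `N` = conductor of the Frey curve `E_{a,b}`, `∀ q` odd prime,
`q ∣ N`: `v_q(Δ_min(E_{a,b})) ≤ K · N^B`.

This file (part 1 of 2; part 2 is `DefiniteXiFreyValuationBoundConverse.lean`, the converse and the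
equivalence `item ↔ ∃ θ, BakerShapeBound θ 0`) proves that ANY effective abc bound of Baker shape
`log c ≤ κ · rad(abc)^θ (log rad(abc))^m` (`Literature.Barriers.ABC.BakerShapeBound θ m`) gives the
item, with exponent `max θ 0 + m` (`freyValuationBound_of_bakerShapeBound`), generalising the landed
discharge from Stewart–Tijdeman's `(15, 0)`
(`Summit.ABC.ABC.Theorems.DefiniteXiPolyFreyDegree.freyValuationBound_of_stewartTijdeman`): so the
item follows from each of `Literature.Barriers.ABC.stewartTijdeman1986_upperBound`,
`Literature.NumberTheory.DiophantineGeometry.stewart_yu` (`(1/3, 3)`), or any future Baker-shape bound.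

References: Stewart–Tijdeman, Monatsh. Math. 102 (1986), Thm 1; Stewart–Yu, Duke Math. J. 108
(2001), Thm 1; Bombieri–Gubler, *Heights in Diophantine Geometry* (2006), Ex. 12.5.10.
-/

-- `Summit.ABC.ABC` is the mandated summit-side namespace (CONVENTIONS §2); the duplicate is deliberate.
set_option linter.dupNamespace false

noncomputable section

namespace Summit.ABC.ABC.Theorems.DefiniteXiFreyValuationBound

open Literature.NumberTheory
open Literature.NumberTheory.EllipticCurves
open Literature.NumberTheory.DiophantineGeometry
open Literature.Barriers.ABC
open UniqueFactorizationMonoid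

/-! ## Baker-shape bounds: removing the logarithmic factor -/

/-- A Baker-shape bound `log c ≤ κ R^θ (log R)^m` gives the log-free shape with exponent
`max θ 0 + m` (`R ≥ 1`, `log R ≤ R`). [folklore] -/
theorem bakerShapeBound_max_add_zero {θ : ℝ} {m : ℕ} (h : BakerShapeBound θ m) :
    BakerShapeBound (max θ 0 + m) 0 := by
  obtain ⟨κ, hκ⟩ := h
  refine ⟨|κ|, fun a b c ht => ?_⟩
  have h1 := hκ a b c ht
  have hR : (1 : ℝ) ≤ (rad a b c : ℝ) := one_le_rad_real a b c
  set R : ℝ := (rad a b c : ℝ) with hRdef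
  have hR0 : 0 < R := by linarith
  have hlog0 : 0 ≤ Real.log R := Real.log_nonneg hR
  have hlogR : Real.log R ≤ R := by linarith [Real.log_le_sub_one_of_pos hR0]
  have hA : 0 ≤ R ^ θ * Real.log R ^ m := by positivity
  calc Real.log c ≤ κ * R ^ θ * Real.log R ^ m := h1
    _ ≤ |κ| * (R ^ θ * Real.log R ^ m) := by
        rw [mul_assoc]; exact mul_le_mul_of_nonneg_right (le_abs_self κ) hA
    _ ≤ |κ| * (R ^ (max θ 0 + (m : ℝ)) * Real.log R ^ 0) := by
        apply mul_le_mul_of_nonneg_left _ (abs_nonneg κ)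
        rw [pow_zero, mul_one, Real.rpow_add hR0, Real.rpow_natCast]
        exact mul_le_mul (Real.rpow_le_rpow_of_exponent_le hR (le_max_left _ _))
          (pow_le_pow_left₀ hlog0 hlogR m) (by positivity) (by positivity)
    _ = |κ| * R ^ (max θ 0 + (m : ℝ)) * Real.log R ^ 0 := by ring

/-- **A Baker-shape bound for signed pairs.** From `BakerShapeBound θ 0` (`log c ≤ κ · rad(abc)^θ`
for abc triples): for coprime integers `a, b` with `ab(a+b) ≠ 0`,
`log |ab(a+b)| ≤ 3 max(κ,0) · rad|ab(a+b)|^θ` — rearrange signs into an abc triple, `|ab(a+b)| ≤ c³`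
(the argument of `DefiniteXiPolyFreyDegree.log_natAbs_le_of_stewartTijdeman` with `15 ↦ θ`). [folklore] -/
theorem log_natAbs_le_of_bakerShapeBound {θ : ℝ} (hST : BakerShapeBound θ 0) :
    ∃ κ : ℝ, 0 ≤ κ ∧ ∀ a b : ℤ, IsCoprime a b → a * b * (a + b) ≠ 0 →
      Real.log ((a * b * (a + b)).natAbs : ℝ) ≤
        κ * ((radical (a * b * (a + b)).natAbs : ℕ) : ℝ) ^ θ := by
  obtain ⟨κ₀, hκ₀⟩ := hST
  refine ⟨3 * max κ₀ 0, by positivity, fun a b hab h0 ↦ ?_⟩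
  -- the bound for an abc triple `(m, n, m + n)` bounds `log (m n (m+n))`
  have key : ∀ m n k : ℕ, 0 < m → 0 < n → m + n = k → Nat.Coprime m n →
      Real.log ((m * n * k : ℕ) : ℝ) ≤
        3 * max κ₀ 0 * ((radical (m * n * k) : ℕ) : ℝ) ^ θ := by
    intro m n k hm hn hk hmn
    have h := hκ₀ m n k ⟨hm, hn, hk, hmn⟩
    rw [pow_zero, mul_one, rad_def] at h
    have hR : (0 : ℝ) ≤ ((radical (m * n * k) : ℕ) : ℝ) ^ θ := by positivity
    have hk0 : 0 < k := by omega
    have hlogk : Real.log k ≤ max κ₀ 0 * ((radical (m * n * k) : ℕ) : ℝ) ^ θ :=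
      h.trans (mul_le_mul_of_nonneg_right (le_max_left _ _) hR)
    have hle : m * n * k ≤ k ^ 3 := by
      have hmk : m ≤ k := by omega
      have hnk : n ≤ k := by omega
      calc m * n * k ≤ k * k * k := by gcongr
        _ = k ^ 3 := by ring
    have hleR : ((m * n * k : ℕ) : ℝ) ≤ (k : ℝ) ^ 3 := by exact_mod_cast hle
    have hpos : (0 : ℝ) < ((m * n * k : ℕ) : ℝ) := by positivity
    calc Real.log ((m * n * k : ℕ) : ℝ) ≤ Real.log ((k : ℝ) ^ 3) := Real.log_le_log hpos hleR
      _ = 3 * Real.log k := by rw [Real.log_pow]; norm_num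
      _ ≤ 3 * (max κ₀ 0 * ((radical (m * n * k) : ℕ) : ℝ) ^ θ) :=
          mul_le_mul_of_nonneg_left hlogk (by norm_num)
      _ = 3 * max κ₀ 0 * ((radical (m * n * k) : ℕ) : ℝ) ^ θ := by ring
  -- the three arrangements of signs
  have hA : a ≠ 0 := fun h ↦ h0 (by rw [h]; ring)
  have hB : b ≠ 0 := fun h ↦ h0 (by rw [h]; ring)
  have hD : a + b ≠ 0 := fun h ↦ h0 (by rw [h]; ring)
  set x := a.natAbs with hx
  set y := b.natAbs with hy
  set z := (a + b).natAbs with hz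
  have hx0 : 0 < x := Int.natAbs_pos.mpr hA
  have hy0 : 0 < y := Int.natAbs_pos.mpr hB
  have hz0 : 0 < z := Int.natAbs_pos.mpr hD
  have hprod : (a * b * (a + b)).natAbs = x * y * z := by simp [hx, hy, hz, Int.natAbs_mul]
  rw [hprod]
  have cop : ∀ {M N : ℤ}, IsCoprime M N → Nat.Coprime M.natAbs N.natAbs := by
    intro M N h
    rw [Nat.Coprime, ← Int.gcd_eq_natAbs]
    exact Int.isCoprime_iff_gcd_eq_one.mp h
  have hAD : IsCoprime a (a + b) := by
    obtain ⟨u, w, huw⟩ := hab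
    exact ⟨u - w, w, by linear_combination huw⟩
  have hBD : IsCoprime b (a + b) := by
    obtain ⟨u, w, huw⟩ := hab
    exact ⟨w - u, u, by linear_combination huw⟩
  have hcases : x + y = z ∨ x + z = y ∨ y + z = x := by omega
  rcases hcases with h | h | h
  · exact key x y z hx0 hy0 h (cop hab)
  · have h1 := key x z y hx0 hz0 h (cop hAD)
    rwa [show x * z * y = x * y * z by ring] at h1
  · have h1 := key y z x hy0 hz0 h (cop hBD)
    rwa [show y * z * x = x * y * z by ring] at h1

/-! ## Any Baker-shape bound gives the item -/

/-- **The item from any Baker-shape bound.** Given `BakerShapeBound θ m` (e.g. Stewart–Tijdeman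
1986 `(15, 0)`, Stewart–Yu 2001 `(1/3, 3)` = `Literature.NumberTheory.DiophantineGeometry.stewart_yu`),
for coprime `a, b` with `ab(a+b) ≠ 0`, conductor `N`, and every odd prime `q`:
`v_q(Δ_min(E_{a,b})) ≤ K · N^{θ'}`, `θ' = max θ 0 + m`. Chain: `v_q(Δ_min) ≤ 2 v_q(ab(a+b))`,
`2^v ≤ |ab(a+b)|`, `log|ab(a+b)| ≤ 3κ R^{θ'}`, `R = rad|ab(a+b)| ≤ 2N`
(`freyValuationBound_of_stewartTijdeman` with `15 ↦ θ'`). [folklore] -/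
theorem freyValuationBound_of_bakerShapeBound {θ : ℝ} {m : ℕ} (hBS : BakerShapeBound θ m) :
    ∃ B K : ℝ, ∀ a b : ℤ, IsCoprime a b → a * b * (a + b) ≠ 0 → ∀ (N : ℕ) [NeZero N],
      (freyCurve a b).conductorNorm ℤ = N → ∀ q : ℕ, q.Prime → q ≠ 2 → q ∣ N →
        ((((freyCurve a b).minimalDiscriminantNorm ℤ).factorization q : ℕ) : ℝ) ≤
          K * (N : ℝ) ^ B := by
  set θ' : ℝ := max θ 0 + m
  have hθ'0 : 0 ≤ θ' := by positivity
  obtain ⟨κ, hκ0, hκ⟩ := log_natAbs_le_of_bakerShapeBound (bakerShapeBound_max_add_zero hBS)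
  refine ⟨θ', 4 * (2 : ℝ) ^ θ' * κ, fun a b hab h0 N _ hN q hq hq2 _ ↦ ?_⟩
  set M : ℤ := a * b * (a + b) with hM
  set v : ℕ := M.natAbs.factorization q with hvdef
  have hM0 : M.natAbs ≠ 0 := Int.natAbs_ne_zero.mpr h0
  -- (1) `v_q(Δ_min) ≤ 2 v`
  have h1R : ((((freyCurve a b).minimalDiscriminantNorm ℤ).factorization q : ℕ) : ℝ) ≤
      2 * (v : ℝ) := by
    exact_mod_cast DefiniteXiPolyFreyDegree.factorization_minimalDiscriminantNorm_freyCurve_le hab h0 hq hq2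
  -- (2) `v · log 2 ≤ log |M|` (`2^v ≤ q^v ≤ |M|`)
  have h2v : 2 ^ v ≤ M.natAbs := (Nat.pow_le_pow_left hq.two_le v).trans (Nat.ordProj_le q hM0)
  have hvlog : (v : ℝ) * Real.log 2 ≤ Real.log (M.natAbs : ℝ) := by
    rw [← Real.log_pow]
    exact Real.log_le_log (by positivity) (by exact_mod_cast h2v)
  -- (3) `log |M| ≤ κ R^θ'`, `R ≤ 2N`
  have h3 := hκ a b hab h0
  have hrad := radical_natAbs_dvd_two_mul_conductorNorm_freyCurve hab h0
  rw [hN] at hrad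
  have hR : ((radical M.natAbs : ℕ) : ℝ) ≤ 2 * (N : ℝ) := by
    exact_mod_cast Nat.le_of_dvd (Nat.pos_of_ne_zero (mul_ne_zero two_ne_zero (NeZero.ne N))) hrad
  have hRθ : ((radical M.natAbs : ℕ) : ℝ) ^ θ' ≤ (2 : ℝ) ^ θ' * (N : ℝ) ^ θ' := by
    rw [← Real.mul_rpow (by norm_num) (Nat.cast_nonneg N)]
    exact Real.rpow_le_rpow (Nat.cast_nonneg _) hR hθ'0
  have hlog2 : (1 / 2 : ℝ) ≤ Real.log 2 := by linarith [Real.log_two_gt_d9]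
  have hv0 : (0 : ℝ) ≤ (v : ℝ) := Nat.cast_nonneg _
  -- assemble: `v ≤ 2 log|M| ≤ 2 κ R^θ' ≤ 2 κ 2^θ' N^θ'`
  have hv : (v : ℝ) ≤ 2 * (κ * ((2 : ℝ) ^ θ' * (N : ℝ) ^ θ')) := by
    have hv2 : (v : ℝ) ≤ 2 * Real.log (M.natAbs : ℝ) := by nlinarith
    calc (v : ℝ) ≤ 2 * Real.log (M.natAbs : ℝ) := hv2
      _ ≤ 2 * (κ * ((radical M.natAbs : ℕ) : ℝ) ^ θ') := by linarith
      _ ≤ 2 * (κ * ((2 : ℝ) ^ θ' * (N : ℝ) ^ θ')) := by gcongr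
  calc ((((freyCurve a b).minimalDiscriminantNorm ℤ).factorization q : ℕ) : ℝ) ≤ 2 * (v : ℝ) := h1R
    _ ≤ 2 * (2 * (κ * ((2 : ℝ) ^ θ' * (N : ℝ) ^ θ'))) := by linarith
    _ = 4 * (2 : ℝ) ^ θ' * κ * (N : ℝ) ^ θ' := by ring

end Summit.ABC.ABC.Theorems.DefiniteXiFreyValuationBound

end
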